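import Summits.HubbardSuperconductivity.HubbardSuperconductivity.Theorems.AnisotropyChordTransferFibre3PiFourier
import Summits.HubbardSuperconductivity.HubbardSuperconductivity.Theorems.AnisotropyChordTransferFibre3N1Identity

/-!
# Route `AnisotropyChord` / H0 rotor rung: PartN33 Layer B — one-loop toolkit and `BtermOneLoop` PROVED

Theory seat `hubbard-h0-rotor-theory-1` g21, memo ROTOR-THEORY-21 §297/§299, typed target `BtermOneLoop`
(`…Fibre3KT1Targets`, PORT PartN33): `B = 2⟨κΠ⁰,Π⁰⟩ = (6/V) Σ_k F₂(k)² F₂(k + K₁)` for even `f`.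

Toolkit (bilinear versions of `corr_fourier` of `…Fibre3PiFourier`):
* `conj_dft_real`, `dft_neg` (`ĝ(−k) = conj ĝ(k)` for real `g`), `dft_cosmod`
  (`FT[cos(K·r) h](k) = ½(ĥ(k−K) + ĥ(k+K))`);
* `corr_fourier2`: `Σ_b u(b) w(b−s) = (1/V) Σ_k û(k) conj ŵ(k) e^{ik·s}`;
* `triple_corr2`: `Σ_{a,b} u(a) h(b) g(b−a) = (1/V) Σ_k conj û(k) ĥ(k) conj ĝ(k)`;
* reindexing lemmas on the pair `(a,b)`: `reindex_diff_w`, `reindex_neg_shift_w`;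
* `kapV_eq`: `κ(a,b) = cos θaₓ + cos θbₓ + cos θ(b−a)ₓ` and its `S₃`-type symmetries.
Then **`btermOneLoop_holds : BtermOneLoop L`** (three equal pieces by the symmetries, one `triple_corr2`, one `dft_cosmod`,
and the reflection `k ↦ −k`).
Prover seat `hubbard-h0-rotor-p1` g23; helper for stmt-HubbardSuperconductivity-19089 (`--supports`).
-/

set_option linter.dupNamespace false
set_option autoImplicit false

noncomputable section

open scoped BigOperators
open Complex

namespace Summit.HubbardSuperconductivity.HubbardSuperconductivity.Theorems.AnisotropyChord.Transfer.Fibre3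

variable (L : ℕ) [NeZero L]

/-! ## Fourier bookkeeping for real functions on the torus -/

/-- `conj ĝ(k) = Σ_r φ_k(r) g(r)` for real `g`. [folklore] -/
theorem conj_dft_real (u : Tor L → ℝ) (k : Tor L) :
    (starRingEnd ℂ) (dft L u k) = ∑ r : Tor L, phase L k r * (u r : ℂ) := by
  unfold dft
  rw [map_sum]
  refine Finset.sum_congr rfl fun r _ => ?_
  rw [map_mul, Complex.conj_conj, Complex.conj_ofReal]

/-- `ĝ(−k) = conj ĝ(k)` for real `g`. [folklore] -/
theorem dft_neg (u : Tor L → ℝ) (k : Tor L) : dft L u (-k) = (starRingEnd ℂ) (dft L u k) := by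
  rw [conj_dft_real]
  unfold dft
  refine Finset.sum_congr rfl fun r _ => ?_
  rw [conj_phase, phase_neg_left, neg_neg]

/-- `|ĝ(−k)|² = |ĝ(k)|²` for real `g`. [folklore] -/
theorem normSq_dft_neg (u : Tor L → ℝ) (k : Tor L) :
    Complex.normSq (dft L u (-k)) = Complex.normSq (dft L u k) := by
  rw [dft_neg, Complex.normSq_conj]

/-- `Re ĝ(−k) = Re ĝ(k)` for real `g`; in particular `F₂(−k) = F₂(k)`. [folklore] -/
theorem F2_neg (f : Tor L → ℝ) (k : Tor L) : F2 L f (-k) = F2 L f k := by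
  unfold F2; rw [dft_neg, Complex.conj_re]

/-- **modulation:** `FT[(Re φ_K)·h](k) = ½(ĥ(k − K) + ĥ(k + K))`. [folklore] -/
theorem dft_cosmod (h : Tor L → ℝ) (K k : Tor L) :
    dft L (fun r => (phase L K r).re * h r) k = (dft L h (k - K) + dft L h (k + K)) / 2 := by
  unfold dft
  rw [eq_div_iff (two_ne_zero), Finset.sum_mul, ← Finset.sum_add_distrib]
  refine Finset.sum_congr rfl fun r _ => ?_
  have h1 : (starRingEnd ℂ) (phase L (k - K) r) = (starRingEnd ℂ) (phase L k r) * phase L K r := by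
    rw [conj_phase, conj_phase, sub_eq_add_neg, phase_add_left, phase_neg_left, neg_neg]
  have h2 : (starRingEnd ℂ) (phase L (k + K) r) = (starRingEnd ℂ) (phase L k r) * (starRingEnd ℂ) (phase L K r) := by
    rw [phase_add_left, map_mul]
  rw [h1, h2]
  push_cast
  rw [Complex.re_eq_add_conj]
  ring

/-- **bilinear correlation in Fourier space:** `Σ_b u(b) w(b − s) = (1/V) Σ_k û(k) conj ŵ(k) e^{ik·s}`. [folklore] -/
theorem corr_fourier2 (u w : Tor L → ℝ) (s : Tor L) :
    ((∑ b : Tor L, u b * w (b - s) : ℝ) : ℂ)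
      = (∑ k : Tor L, dft L u k * (starRingEnd ℂ) (dft L w k) * phase L k s) / ((L : ℂ) ^ 2) := by
  have hV : ((L : ℂ) ^ 2) ≠ 0 := by
    have : (L : ℂ) ≠ 0 := by exact_mod_cast (NeZero.ne L)
    positivity
  rw [eq_div_iff hV]
  unfold dft
  have e1 : ∀ k : Tor L, (∑ r : Tor L, (starRingEnd ℂ) (phase L k r) * (u r : ℂ))
        * (starRingEnd ℂ) (∑ r' : Tor L, (starRingEnd ℂ) (phase L k r') * (w r' : ℂ)) * phase L k s
      = ∑ r : Tor L, ∑ r' : Tor L, ((u r : ℂ) * (w r' : ℂ)) * phase L k (r' + s - r) := by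
    intro k
    rw [map_sum]
    simp only [map_mul, Complex.conj_conj, Complex.conj_ofReal]
    rw [Finset.sum_mul_sum, Finset.sum_mul]
    refine Finset.sum_congr rfl fun r _ => ?_
    rw [Finset.sum_mul]
    refine Finset.sum_congr rfl fun r' _ => ?_
    rw [← conj_phase_mul_mul L k r r' s]; ring
  rw [Finset.sum_congr rfl fun k _ => e1 k, Finset.sum_comm]
  simp_rw [Finset.sum_comm (γ := Tor L) (s := (Finset.univ : Finset (Tor L))) (t := (Finset.univ : Finset (Tor L)))
    (f := fun k r' => ((u _ : ℂ) * (w r' : ℂ)) * phase L k (r' + s - _))]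
  have e2 : ∀ r : Tor L, ∑ r' : Tor L, ∑ k : Tor L, ((u r : ℂ) * (w r' : ℂ)) * phase L k (r' + s - r)
      = (u r : ℂ) * (w (r - s) : ℂ) * (L : ℂ) ^ 2 := by
    intro r
    have : ∀ r' : Tor L, ∑ k : Tor L, ((u r : ℂ) * (w r' : ℂ)) * phase L k (r' + s - r)
        = if r - s = r' then (u r : ℂ) * (w r' : ℂ) * (L : ℂ) ^ 2 else 0 := by
      intro r'
      rw [← Finset.mul_sum, sum_phase_left]
      have hiff : (r' + s - r = 0) ↔ (r - s = r') := by
        constructor <;> intro h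
        · have := sub_eq_zero.mp h; rw [← this]; abel
        · rw [← h]; abel
      simp only [hiff]
      split_ifs <;> simp
    rw [Finset.sum_congr rfl fun r' _ => this r', Finset.sum_ite_eq Finset.univ (r - s)]
    simp
  rw [Finset.sum_congr rfl fun r _ => e2 r, ← Finset.sum_mul]
  push_cast
  rfl

/-- **triple correlation in Fourier space:** `Σ_{a,b} u(a) h(b) g(b − a) = (1/V) Σ_k conj û(k)·ĥ(k)·conj ĝ(k)`. [folklore] -/
theorem triple_corr2 (u h g : Tor L → ℝ) :
    ((∑ a : Tor L, ∑ b : Tor L, u a * h b * g (b - a) : ℝ) : ℂ)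
      = (∑ k : Tor L, (starRingEnd ℂ) (dft L u k) * dft L h k * (starRingEnd ℂ) (dft L g k)) / ((L : ℂ) ^ 2) := by
  have e1 : ∀ a : Tor L, ((∑ b : Tor L, u a * h b * g (b - a) : ℝ) : ℂ)
      = (u a : ℂ) * ((∑ k : Tor L, dft L h k * (starRingEnd ℂ) (dft L g k) * phase L k a) / ((L : ℂ) ^ 2)) := by
    intro a
    rw [← corr_fourier2]
    push_cast
    rw [Finset.mul_sum]
    refine Finset.sum_congr rfl fun b _ => ?_
    ring
  push_cast
  have e1' : ∀ a : Tor L, ∑ b : Tor L, (u a : ℂ) * (h b : ℂ) * (g (b - a) : ℂ)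
      = (u a : ℂ) * ((∑ k : Tor L, dft L h k * (starRingEnd ℂ) (dft L g k) * phase L k a) / ((L : ℂ) ^ 2)) := by
    intro a; rw [← e1 a]; push_cast; rfl
  rw [Finset.sum_congr rfl fun a _ => e1' a]
  simp_rw [mul_div_assoc', Finset.mul_sum]
  rw [← Finset.sum_div, Finset.sum_comm]
  congr 1
  refine Finset.sum_congr rfl fun k _ => ?_
  rw [conj_dft_real L u k, Finset.sum_mul, Finset.sum_mul]
  refine Finset.sum_congr rfl fun a _ => ?_
  ring

/-! ## Reindexing the pair sum `(a, b)` -/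

/-- `Σ_{a,b} ω(a,b) U(b−a) G₁(a) G₂(b) = Σ_{x,y} ω(y−x,y) U(x) G₁(y−x) G₂(y)` (`a = y − x`). [folklore] -/
theorem reindex_diff_w (ω : Tor L → Tor L → ℝ) (U G1 G2 : Tor L → ℝ) :
    ∑ a : Tor L, ∑ b : Tor L, ω a b * U (b - a) * G1 a * G2 b
      = ∑ x : Tor L, ∑ y : Tor L, ω (y - x) y * U x * G1 (y - x) * G2 y := by
  rw [Finset.sum_comm]
  conv_rhs => rw [Finset.sum_comm]
  refine Finset.sum_congr rfl fun b _ => ?_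
  rw [← (Equiv.subLeft b).sum_comp (fun a => ω a b * U (b - a) * G1 a * G2 b)]
  refine Finset.sum_congr rfl fun x _ => ?_
  simp only [Equiv.subLeft_apply, sub_sub_cancel]

/-- `Σ_{a,b} ω(a,b) H(−a) G(b) H₂(b−a) = Σ_{x,y} ω(−x, y−x) H(x) G(y−x) H₂(y)` (`a = −x`, `b = y − x`). [folklore] -/
theorem reindex_neg_shift_w (ω : Tor L → Tor L → ℝ) (H G H2 : Tor L → ℝ) :
    ∑ a : Tor L, ∑ b : Tor L, ω a b * H (-a) * G b * H2 (b - a)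
      = ∑ x : Tor L, ∑ y : Tor L, ω (-x) (y - x) * H x * G (y - x) * H2 y := by
  rw [← Equiv.sum_comp (Equiv.neg (Tor L)) (fun a => ∑ b : Tor L, ω a b * H (-a) * G b * H2 (b - a))]
  refine Finset.sum_congr rfl fun x _ => ?_
  simp only [Equiv.neg_apply, neg_neg, sub_neg_eq_add]
  rw [← (Equiv.subRight x).sum_comp (fun b => ω (-x) b * H x * G b * H2 (b + x))]
  refine Finset.sum_congr rfl fun y _ => ?_
  simp only [Equiv.subRight_apply, sub_add_cancel]

/-- swapping the two summation variables. [folklore] -/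
theorem reindex_swap (F : Tor L → Tor L → ℝ) :
    ∑ a : Tor L, ∑ b : Tor L, F a b = ∑ x : Tor L, ∑ y : Tor L, F y x := Finset.sum_comm

/-! ## `κ` and its symmetries -/

/-- `κ(a,b) = Re φ(a) + Re φ(b) + Re φ(b − a)` (`φ = e^{iK₁·}`). [folklore] -/
theorem kapV_eq (c : Cfg L) :
    kapV L c = (phase L (K1 L) c.1).re + (phase L (K1 L) c.2).re + (phase L (K1 L) (c.2 - c.1)).re := by
  unfold kapV vfun
  rw [Complex.normSq_add, Complex.normSq_add, normSq_phase, normSq_phase, Complex.normSq_one]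
  have h1 : ((1 : ℂ) * (starRingEnd ℂ) (phase L (K1 L) c.1)).re = (phase L (K1 L) c.1).re := by
    rw [one_mul, Complex.conj_re]
  have h2 : ((1 + phase L (K1 L) c.1) * (starRingEnd ℂ) (phase L (K1 L) c.2)).re
      = (phase L (K1 L) c.2).re + (phase L (K1 L) (c.2 - c.1)).re := by
    rw [add_mul, one_mul, Complex.add_re, Complex.conj_re, conj_phase, ← phase_add,
      show c.2 - c.1 = -(c.1 + -c.2) by abel, ← conj_phase, Complex.conj_re]
  rw [h1, h2]
  ring

/-- `Re φ(−r) = Re φ(r)`. [folklore] -/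
theorem phase_re_neg (K r : Tor L) : (phase L K (-r)).re = (phase L K r).re := by
  rw [← conj_phase, Complex.conj_re]

/-- `κ(y − x, y) = κ(x, y)`. [folklore] -/
theorem kapV_diff (x y : Tor L) : kapV L (y - x, y) = kapV L (x, y) := by
  rw [kapV_eq, kapV_eq]
  simp only [sub_sub_cancel]
  ring

/-- `κ(−x, y − x) = κ(x, y)`. [folklore] -/
theorem kapV_neg_shift (x y : Tor L) : kapV L (-x, y - x) = kapV L (x, y) := by
  rw [kapV_eq, kapV_eq]
  simp only [sub_neg_eq_add, sub_add_cancel, phase_re_neg]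
  ring

/-- `κ(y, x) = κ(x, y)`. [folklore] -/
theorem kapV_swap (x y : Tor L) : kapV L (y, x) = kapV L (x, y) := by
  rw [kapV_eq, kapV_eq]
  simp only
  rw [show x - y = -(y - x) by abel, phase_re_neg]
  ring

/-! ## `BtermOneLoop` -/

/-- the canonical weighted triple `T = Σ_{x,y} Re φ(x)·g(x) g(y) g(y−x)` in Fourier space:
`T = (1/V) Σ_k F₂(k)² F₂(k+K₁)` for `g = f²`, `f` even. [folklore] -/
theorem weighted_triple_fourier {f : Tor L → ℝ} (hev : ∀ r : Tor L, f (-r) = f r) :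
    ∑ x : Tor L, ∑ y : Tor L, (phase L (K1 L) x).re * f x ^ 2 * f y ^ 2 * f (y - x) ^ 2
      = (∑ k : Tor L, F2 L f k ^ 2 * F2 L f (k + K1 L)) / (L : ℝ) ^ 2 := by
  have hgev : ∀ r : Tor L, (fun r => f r ^ 2) (-r) = (fun r => f r ^ 2) r := by intro r; simp only [hev]
  have hreal : ∀ k : Tor L, dft L (fun r => f r ^ 2) k = ((F2 L f k : ℝ) : ℂ) := fun k => by
    rw [dft_even_eq_re L hgev]; rfl
  have hl := triple_corr2 L (fun r => (phase L (K1 L) r).re * f r ^ 2) (fun r => f r ^ 2) (fun r => f r ^ 2)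
  -- simplify the Fourier side
  have hmod : ∀ k : Tor L, dft L (fun r => (phase L (K1 L) r).re * f r ^ 2) k
      = (((F2 L f (k - K1 L) + F2 L f (k + K1 L)) / 2 : ℝ) : ℂ) := by
    intro k
    rw [show (fun r => (phase L (K1 L) r).re * f r ^ 2) = (fun r => (phase L (K1 L) r).re * (fun r => f r ^ 2) r)
      from rfl, dft_cosmod, hreal, hreal]
    push_cast; ring
  have hk : ∀ k : Tor L, (starRingEnd ℂ) (dft L (fun r => (phase L (K1 L) r).re * f r ^ 2) k)
        * dft L (fun r => f r ^ 2) k * (starRingEnd ℂ) (dft L (fun r => f r ^ 2) k)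
      = (((F2 L f (k - K1 L) + F2 L f (k + K1 L)) / 2 * F2 L f k ^ 2 : ℝ) : ℂ) := by
    intro k
    rw [hmod, hreal, Complex.conj_ofReal, Complex.conj_ofReal]
    push_cast; ring
  rw [Finset.sum_congr rfl fun k _ => hk k] at hl
  have hV : ((L : ℂ) ^ 2) = (((L : ℝ) ^ 2 : ℝ) : ℂ) := by push_cast; ring
  rw [hV, ← Complex.ofReal_sum, ← Complex.ofReal_div] at hl
  have hl' := Complex.ofReal_injective hl
  rw [hl']
  congr 1
  -- the reflection `k ↦ −k` equates the two halves
  have hsym : ∑ k : Tor L, F2 L f (k - K1 L) * F2 L f k ^ 2 = ∑ k : Tor L, F2 L f (k + K1 L) * F2 L f k ^ 2 := by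
    rw [← Equiv.sum_comp (Equiv.neg (Tor L)) (fun k => F2 L f (k - K1 L) * F2 L f k ^ 2)]
    refine Finset.sum_congr rfl fun k _ => ?_
    simp only [Equiv.neg_apply]
    rw [show -k - K1 L = -(k + K1 L) by abel, F2_neg, F2_neg]
  have : ∑ k : Tor L, (F2 L f (k - K1 L) + F2 L f (k + K1 L)) / 2 * F2 L f k ^ 2
      = (∑ k : Tor L, F2 L f (k - K1 L) * F2 L f k ^ 2 + ∑ k : Tor L, F2 L f (k + K1 L) * F2 L f k ^ 2) / 2 := by
    rw [← Finset.sum_add_distrib, Finset.sum_div]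
    refine Finset.sum_congr rfl fun k _ => ?_; ring
  rw [this, hsym]
  rw [← two_mul, mul_div_cancel_left₀ _ (two_ne_zero)]
  refine Finset.sum_congr rfl fun k _ => ?_; ring

/-- `Σ_c κ(c) Π⁰(c)² = 3T` (the three pair phases contribute equally; `f` even). [folklore] -/
theorem sum_kapV_piR_sq {f : Tor L → ℝ} (hev : ∀ r : Tor L, f (-r) = f r) :
    ∑ c : Cfg L, kapV L c * piR L f c ^ 2
      = 3 * ∑ x : Tor L, ∑ y : Tor L, (phase L (K1 L) x).re * f x ^ 2 * f y ^ 2 * f (y - x) ^ 2 := by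
  have hgev : ∀ r : Tor L, f (-r) ^ 2 = f r ^ 2 := by intro r; rw [hev]
  rw [Fintype.sum_prod_type]
  simp only [kapV_eq, piR]
  have split : ∀ a b : Tor L,
      ((phase L (K1 L) a).re + (phase L (K1 L) b).re + (phase L (K1 L) (b - a)).re) * (f a * f b * f (b - a)) ^ 2
        = (phase L (K1 L) a).re * f a ^ 2 * f b ^ 2 * f (b - a) ^ 2
          + (phase L (K1 L) b).re * f a ^ 2 * f b ^ 2 * f (b - a) ^ 2
          + (fun a b => (1 : ℝ)) a b * ((phase L (K1 L) (b - a)).re * f (b - a) ^ 2) * f a ^ 2 * f b ^ 2 := by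
    intro a b; ring
  simp_rw [split, Finset.sum_add_distrib]
  -- second piece: swap
  have h2 : ∑ a : Tor L, ∑ b : Tor L, (phase L (K1 L) b).re * f a ^ 2 * f b ^ 2 * f (b - a) ^ 2
      = ∑ x : Tor L, ∑ y : Tor L, (phase L (K1 L) x).re * f x ^ 2 * f y ^ 2 * f (y - x) ^ 2 := by
    rw [reindex_swap]
    refine Finset.sum_congr rfl fun x _ => Finset.sum_congr rfl fun y _ => ?_
    rw [show x - y = -(y - x) by abel, hgev]; ring
  -- third piece: `a = y − x`
  have h3 : ∑ a : Tor L, ∑ b : Tor L,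
        (fun a b => (1 : ℝ)) a b * ((phase L (K1 L) (b - a)).re * f (b - a) ^ 2) * f a ^ 2 * f b ^ 2
      = ∑ x : Tor L, ∑ y : Tor L, (phase L (K1 L) x).re * f x ^ 2 * f y ^ 2 * f (y - x) ^ 2 := by
    rw [reindex_diff_w L (fun a b => (1 : ℝ)) (fun r => (phase L (K1 L) r).re * f r ^ 2) (fun r => f r ^ 2)
      (fun r => f r ^ 2)]
    refine Finset.sum_congr rfl fun x _ => Finset.sum_congr rfl fun y _ => ?_
    ring
  rw [h2, h3]
  ring

/-- ★ **`BtermOneLoop L` holds:** `B = (6/V) Σ_k F₂(k)² F₂(k + K₁)` for even `f`. [folklore] -/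
theorem btermOneLoop_holds : BtermOneLoop L := by
  intro f hev
  unfold Bterm
  rw [sum_kapV_piR_sq L hev, weighted_triple_fourier L hev]
  ring

end Summit.HubbardSuperconductivity.HubbardSuperconductivity.Theorems.AnisotropyChord.Transfer.Fibre3

end
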